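import Summits.BirchSwinnertonDyer.BirchSwinnertonDyer.Theorems.EisensteinPrimesResidualPairStableLine
import Summits.BirchSwinnertonDyer.BirchSwinnertonDyer.Theorems.EisensteinPrimesCharGrSelmerCorankGeOfFacts
import Literature.NumberTheory.EllipticCurves.HeegnerPointsKolyvaginConjugation
import Literature.NumberTheory.GaloisRepresentations.RestrictFieldSemisimple
import Literature.NumberTheory.EllipticCurves.SelmerCorankProofs
import HarnessLib

/-!
# The lattice binder «`E(K)[p] = 0`» from «`W[p]` has exactly one rational `p`-line, and `Γ_K` moves it»
# (cell `bsd-eis`, width seat `bsd-line-x2-p2` gen 10; crux 4 `BSDpOnCellC` stmt-BirchSwinnertonDyer-19034, line b1 v12, the SPLIT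
# conjunct of the wall `stub_imprimitiveCount`)

HONEST FRAMING (run/shared/lean/pub/bsd-eis/): helper theorems only (0 defs, 0 named facts introduced, 0 sorry); `--supports -19034`, closes no
registered stub; the skeleton of record b1 v12 (sha256 155e218d…) is UNCHANGED (W-79); no summit statement / BSD / MC / IMC is proved; 0 cells /
labels / tiers move.

## Why

This seat's split wall (`SplitMultWallOfBr.imprimitiveCount_split_of_br_of_pub`, p678426) carries two lattice binders beyond conj. 2's text:
(a) «every rational `p`-line of `W` is ramified at `p`» and (b) «`E(K)[p] = 0`» — the x1 line's `hlat`/`htor`. Binder (b) depends on the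
Heegner field `K` chosen INSIDE the composition. Keller–Yin's standing normalisation (arXiv:2402.12781v2 §0.1 L263, §1.3 L886: "we can fix a
non-split extension `0 → 𝔽(φ) → ρ̄_f → 𝔽(ψ) → 0` where the first character restricts to `ω` on `G_p` … no trivial subrepresentation over
`G_K` … by isogeny invariance") is a property of `W` ALONE: `W[p]` is a NON-SPLIT extension (⟺ it has EXACTLY ONE `Γ_ℚ`-stable line) whose
line is ramified at `p`. This file proves that the `W`-intrinsic form implies (b) for every Galois `K/ℚ` in which `Γ_K` moves the line:

* §1 `eq_zero_of_forall_smul_eq_of_unique_stable_line` — group theory: `G` acts on `T` of order `p²`, `H ⊴ G`, `Φ ≤ T` is the UNIQUE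
  `G`-stable subgroup of order `p`, and some `h ∈ H` moves some point of `Φ`; then `T^H = 0`. (The fixed group `T^H` is `G`-stable by
  normality; of order `1`, `p` or `p²`; order `p` forces `T^H = Φ` and order `p²` forces `Φ ≤ T^H`, both against the moving `h`.)
* §2 `torsion_eq_zero_of_unique_rationalLine` — `W/ℚ`, `K/ℚ` Galois, `Φ` the unique rational `p`-line, some `σ ∈ Γ_K` (through
  `absGaloisRestrict ℚ K`, whose image is normal: `normal_range_absGaloisRestrict`) moving a point of `Φ` ⟹ `E(K)[p] = 0`
  (`∀ Q ∈ E(K), p • Q = 0 → Q = 0`): a `K`-rational `p`-torsion point gives, through `E(K) ↪ E_K(K̄) ≃ E(ℚ̄)` (`toGeomPoints`,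
  `RatClosure.pointsEquiv`, equivariant along `absGaloisRestrict`), a `Γ_K`-fixed point of `E[p](ℚ̄)`, which §1 kills.
* §3 `exists_smul_ne_of_unitChar_ne_one` — the moving element from the Teichmüller character: if `θ` is the Teichmüller lift of `Γ_ℚ` on the
  rational line `Φ` (`IsTeichmullerLiftOn`) and `unitChar θ σ ≠ 1`, then `σ` moves a point of `Φ` (equivariant embedding `Φ ↪ (F/𝒪)(θ)[p]`,
  `ResidualPairStableLine.exists_embedding_charModule_of_card_eq`; a Teichmüller character is `1` at `σ` as soon as `σ` fixes the `p`-torsion,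
  `CharGrSelmerCorankGeOfFacts.unitChar_eq_one_of_forall_torsion_smul_eq`). At a split multiplicative `p` with binder (a), `θsub|_K` is
  ramified at `v̄` (this seat's `SplitMultOrientation`, p675389), so an inertia element at `v̄` — inside `Γ_K` — moves `Φ`.

The companion file `…BSDpOnCellCImprimitiveCountSplitOfBrNonsplitExt` restates the split wall with (b) replaced by «`W` has exactly one rational
`p`-line».

References: [KellerYin2024] §0.1 (arXiv:2402.12781v2 TeX L263), §1.3 (L886), §1.4 (L1063–1086); [SerreLocalFields1979] IV §2 (Teichmüller units);
[SilvermanAEC2009] III.8 (E[p] ≅ (ℤ/p)²), VIII.§1 (E(K) ↪ E(K̄), Galois descent); [Bellaiche2009Ribet] §1 (non-split reducible lattices; shape only).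
-/

set_option autoImplicit false
set_option linter.dupNamespace false -- the summit namespace `…BirchSwinnertonDyer.BirchSwinnertonDyer.Theorems` (Sub = Summit, D-0017) trips it

noncomputable section

open scoped Classical

namespace Summit.BirchSwinnertonDyer.BirchSwinnertonDyer.Theorems.SplitMultLatticeBinders

open NumberField IsDedekindDomain Field WeierstrassCurve
open Literature.NumberTheory.EllipticCurves Literature.NumberTheory.EllipticCurves.GreenbergSelmer
  Literature.NumberTheory.GaloisRepresentations Literature.NumberTheory.EllipticCurves.KellerYin2024
  Literature.NumberTheory.IwasawaTheory Literature.NumberTheory.EllipticCurves.Rank1Residual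
  Summit.BirchSwinnertonDyer.Rank1Residual.X2.ResidualDevissageModules
  Summit.BirchSwinnertonDyer.BirchSwinnertonDyer.Theorems

/-! ### §1 Group theory: a normal subgroup moving the unique stable line fixes nothing -/

section Group

variable {G : Type*} [Group G] {T : Type*} [AddCommGroup T] [DistribMulAction G T] {p : ℕ} [hp : Fact p.Prime]

/-- **`T^H = 0` when `H ⊴ G` moves the unique `G`-stable line.** `G` acts on an additive group `T` of order `p²`; `H` is a normal
subgroup; `Φ ≤ T` is the UNIQUE `G`-stable subgroup of order `p`; some `h ∈ H` moves some point of `Φ`. Then every `H`-fixed point of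
`T` is `0`: the fixed subgroup `T^H` is `G`-stable (normality), its order divides `p²`, order `p` would make it `Φ` and order `p²` would
make it `T ⊇ Φ` — both contradicted by the moving `h`. [cite: KellerYin2024, §0.1 (arXiv:2402.12781v2 TeX L263: "non-split … no trivial subrepresentation over G_K")]
[cite: SilvermanAEC2009, III.8 (shape: E[p] of order p²)] -/
theorem eq_zero_of_forall_smul_eq_of_unique_stable_line (hT : Nat.card T = p ^ 2) (H : Subgroup G) (hH : H.Normal)
    (Φ : AddSubgroup T)
    (huniq : ∀ Ψ : AddSubgroup T, Nat.card Ψ = p → (∀ g : G, ∀ P ∈ Ψ, g • P ∈ Ψ) → Ψ = Φ)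
    (hmove : ∃ h ∈ H, ∃ P ∈ Φ, h • P ≠ P) {P : T} (hP : ∀ h ∈ H, h • P = P) : P = 0 := by
  have hpp : p.Prime := hp.out
  haveI : Finite T := Nat.finite_of_card_ne_zero (by rw [hT]; exact pow_ne_zero 2 hpp.ne_zero)
  -- the `H`-fixed subgroup
  let V : AddSubgroup T :=
    { carrier := {Q | ∀ h ∈ H, h • Q = Q}
      add_mem' := fun {a b} ha hb h hh ↦ by rw [smul_add, ha h hh, hb h hh]
      zero_mem' := fun h _ ↦ smul_zero h
      neg_mem' := fun {a} ha h hh ↦ by rw [smul_neg, ha h hh] }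
  have hmemV : ∀ Q : T, Q ∈ V ↔ ∀ h ∈ H, h • Q = Q := fun _ ↦ Iff.rfl
  -- `V` is `G`-stable (`H` is normal)
  have hstab : ∀ g : G, ∀ Q ∈ V, g • Q ∈ V := by
    intro g Q hQ
    rw [hmemV]
    intro h hh
    have hconj : g⁻¹ * h * g ∈ H := by
      have h' := hH.conj_mem h hh g⁻¹
      rwa [inv_inv] at h'
    calc h • g • Q = g • ((g⁻¹ * h * g) • Q) := by rw [mul_smul, mul_smul, smul_inv_smul]
      _ = g • Q := by rw [(hmemV Q).mp hQ _ hconj]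
  obtain ⟨h₀, hh₀, P₀, hP₀, hne⟩ := hmove
  -- the order of `V` divides `p²`
  have hcard : Nat.card V ∣ p ^ 2 := hT ▸ V.card_addSubgroup_dvd_card
  obtain ⟨k, hk, hkV⟩ := (Nat.dvd_prime_pow hpp).mp hcard
  interval_cases k
  · -- `#V = 1`: `V = ⊥`
    have hbot : V = ⊥ := AddSubgroup.eq_bot_of_card_eq V (by rw [hkV, pow_zero])
    have hPV : P ∈ V := (hmemV P).mpr hP
    rw [hbot] at hPV
    exact (AddSubgroup.mem_bot).mp hPV
  · -- `#V = p`: `V = Φ`, but `h₀` moves `P₀ ∈ Φ`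
    exfalso
    have hVΦ : V = Φ := huniq V (by rw [hkV, pow_one]) hstab
    rw [← hVΦ] at hP₀
    exact hne ((hmemV P₀).mp hP₀ h₀ hh₀)
  · -- `#V = p²`: `V = ⊤ ⊇ Φ`
    exfalso
    have htop : V = ⊤ := AddSubgroup.eq_top_of_card_eq V (by rw [hkV, hT])
    have hPV : P₀ ∈ V := by rw [htop]; exact AddSubgroup.mem_top _
    exact hne ((hmemV P₀).mp hPV h₀ hh₀)

end Group

/-! ### §2 The curve: `E(K)[p] = 0` from a unique rational line moved by `Γ_K` -/

section Curve

variable {p : ℕ} [hp : Fact p.Prime]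

/-- **«`E(K)[p] = 0`» from «`W[p]` has exactly one rational `p`-line, and `Γ_K` moves it».** `W/ℚ` elliptic, `K/ℚ` a Galois number field,
`Φ ≤ W[p](ℚ̄)` such that every rational `p`-line equals `Φ` (so `W[p]` is a non-split extension), and some `σ ∈ Γ_K` — acting through
`absGaloisRestrict ℚ K` — moves a point of `Φ`. Then `E(K)` has no point of order `p`. Proof: a `K`-rational `Q` with `p • Q = 0` gives a point
`m = e⁻¹(Q) ∈ E[p](ℚ̄)` (`E(K) ↪ E_K(K̄) ≃ E(ℚ̄)`, `toGeomPoints`, `RatClosure.pointsEquiv`) fixed by the image `H` of `Γ_K` in `Γ_ℚ`, a NORMAL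
subgroup (`normal_range_absGaloisRestrict`); §1 gives `m = 0`. (Keller–Yin: "non-split … so in particular it's non-trivial over `G_K`".)
[cite: KellerYin2024, §0.1 (arXiv:2402.12781v2 TeX L263), §1.3 (L886)] [cite: SilvermanAEC2009, VIII.§1 (E(K) ↪ E(K̄); Galois descent)] -/
theorem torsion_eq_zero_of_unique_rationalLine (W : WeierstrassCurve ℚ) [W.IsElliptic]
    (K : Type) [Field K] [NumberField K] [IsGalois ℚ K]
    {Φ : AddSubgroup (geomTorsion W (p : ℤ))} (huniq : ∀ Ψ : AddSubgroup (geomTorsion W (p : ℤ)), IsRationalLine W p Ψ → Ψ = Φ)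
    (hmove : ∃ σ : absoluteGaloisGroup K, ∃ P ∈ Φ, absGaloisRestrict ℚ K σ • P ≠ P) :
    ∀ Q : (W.baseChange K).toAffine.Point, p • Q = 0 → Q = 0 := by
  intro Q hQ
  have hpp : p.Prime := hp.out
  haveI : (W.baseChange K).IsElliptic := inferInstanceAs (W.map (algebraMap ℚ K)).IsElliptic
  set H : Subgroup (absoluteGaloisGroup ℚ) := (absGaloisRestrict ℚ K).range with hHdef
  have hH : H.Normal := normal_range_absGaloisRestrict ℚ K
  -- the point in `E(ℚ̄)`
  set e : geomPoints W ≃+ geomPoints (W.baseChange K) := RatClosure.pointsEquiv (K := K) W with hedef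
  set m₀ : geomPoints (W.baseChange K) := toGeomPoints (W.baseChange K) Q with hm₀def
  have hm₀ : ((p : ℕ) : ℤ) • m₀ = 0 := by rw [natCast_zsmul, hm₀def, ← map_nsmul, hQ, map_zero]
  set P₁ : geomPoints W := e.symm m₀ with hP₁def
  have heP₁ : e P₁ = m₀ := e.apply_symm_apply m₀
  have hP₁ : P₁ ∈ geomTorsion W (p : ℤ) := by
    rw [mem_geomTorsion_iff, ← e.injective.eq_iff, map_zsmul, heP₁, map_zero]
    exact hm₀
  -- it is fixed by `H`
  have hfix : ∀ h ∈ H, h • (⟨P₁, hP₁⟩ : geomTorsion W (p : ℤ)) = ⟨P₁, hP₁⟩ := by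
    rintro _ ⟨σ, rfl⟩
    apply Subtype.ext
    rw [AddSubgroup.torsionBy.coe_smul]
    change absGaloisRestrict ℚ K σ • P₁ = P₁
    apply e.injective
    rw [RatClosure.pointsEquiv_smul, heP₁, hm₀def, smul_toGeomPoints]
  -- §1
  have hmove' : ∃ h ∈ H, ∃ P ∈ Φ, h • P ≠ P := by
    obtain ⟨σ, P, hP, hne⟩ := hmove
    exact ⟨absGaloisRestrict ℚ K σ, ⟨σ, rfl⟩, P, hP, hne⟩
  have h0 := eq_zero_of_forall_smul_eq_of_unique_stable_line (W.natCard_geomTorsion_prime_eq_sq hpp) H hH Φ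
    (fun Ψ hc hs ↦ huniq Ψ ⟨hc, hs⟩) hmove' hfix
  have hP0 : P₁ = 0 := congrArg Subtype.val h0
  have hm0 : m₀ = 0 := by rw [← heP₁, hP0, map_zero]
  exact toGeomPoints_injective (W.baseChange K) (by rw [map_zero]; exact hm0)

/-! ### §3 The moving element from the Teichmüller character of the line -/

/-- **If `unitChar θ σ ≠ 1` for the Teichmüller character `θ` of `Γ_ℚ` on the rational line `Φ`, then `σ` moves a point of `Φ`.** (`Φ` as a
stable subgroup embeds `Γ_ℚ`-equivariantly onto `(F/𝒪)(θ)[p]`; if `σ` fixed `Φ` pointwise it would fix `(F/𝒪)(θ)[p]`, forcing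
`unitChar θ σ = 1` for a Teichmüller character.) With this seat's `SplitMultOrientation` (p675389: at a split multiplicative `p` with the line
ramified at `p`, `θsub|_K` is ramified at `v̄`), an inertia element at `v̄` — inside `Γ_K` — is such a `σ`.
[cite: KellerYin2024, §1.1 (arXiv:2402.12781v2 TeX L441) and §1.4 (L1063–1086)] [cite: SerreLocalFields1979, IV §2 (Teichmüller units)] -/
theorem exists_smul_ne_of_unitChar_ne_one (W : WeierstrassCurve ℚ) {Φ : AddSubgroup (geomTorsion W (p : ℤ))}
    (hΦ : IsRationalLine W p Φ) {θ : FramedGaloisRep ℚ (padicCoeffIntegers (∅ : Set (PadicAlgCl p))) 1}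
    (hs : IsTeichmullerLiftOn (∅ : Set (PadicAlgCl p)) (Φ.map (geomTorsion W (p : ℤ)).subtype) θ)
    {σ : absoluteGaloisGroup ℚ} (hσ : unitChar θ σ ≠ 1) : ∃ P ∈ Φ, σ • P ≠ P := by
  by_contra hall
  push Not at hall
  -- `Φ` as a stable subgroup, with the scalar action read through `θ`
  let L : StableSubgroup (absoluteGaloisGroup ℚ) (geomTorsion W (p : ℤ)) :=
    { toAddSubgroup := Φ, smul_mem' := fun g _ hm ↦ hΦ.2 g _ hm }
  have hL : Nat.card L.Sub = p := hΦ.1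
  have hact : ∀ τ : absoluteGaloisGroup ℚ, ∃ a : ℤ,
      ((unitChar θ τ : ℤ_[p]ˣ) : ℤ_[p]) - (a : ℤ_[p]) ∈ Ideal.span {(p : ℤ_[p]) ^ 1} ∧ ∀ c : L.Sub, τ • c = a • c := by
    intro τ
    obtain ⟨a, ha, hΦa⟩ := hs.exists_smul_eq τ
    refine ⟨a, ResidualPairStableLine.unitChar_sub_intCast_mem_span θ τ ha, fun c ↦ L.incl_injective ?_⟩
    rw [L.incl_smul, map_zsmul]
    apply Subtype.ext
    rw [AddSubgroup.torsionBy.coe_smul, AddSubgroupClass.coe_zsmul]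
    exact hΦa _ ⟨L.incl c, c.2, rfl⟩
  obtain ⟨j, hj, -, hrange⟩ := ResidualPairStableLine.exists_embedding_charModule_of_card_eq θ hL hact
  -- `σ` fixes `Φ`, hence `(F/𝒪)(θ)[p]`
  have hfixΦ : ∀ c : L.Sub, σ • c = c := fun c ↦ L.incl_injective (by rw [L.incl_smul]; exact hall _ c.2)
  have hg : ∀ m : charModule (∅ : Set (PadicAlgCl p)) θ, p • m = 0 → σ • m = m := by
    intro m hm
    obtain ⟨c, rfl⟩ := (hrange m).mpr hm
    rw [← hj, hfixΦ]
  exact hσ (CharGrSelmerCorankGeOfFacts.unitChar_eq_one_of_forall_torsion_smul_eq θ hs.1 hg)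

end Curve

end Summit.BirchSwinnertonDyer.BirchSwinnertonDyer.Theorems.SplitMultLatticeBinders

end
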